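import Summits.CriticalPhenomena.PercolationContinuityZ3.Theorems.Transplant.BoxProdZ2ConcReachExcess
import Summits.CriticalPhenomena.PercolationContinuityZ3.Theorems.Transplant.BoxProdZ2ConcReachDeep
import Summits.CriticalPhenomena.PercolationContinuityZ3.Theorems.Transplant.PlanarCellsPSep3
import Summits.CriticalPhenomena.PercolationContinuityZ3.Theorems.Transplant.KNCellsBoxProdZ2ConcReachKits
import Summits.CriticalPhenomena.PercolationContinuityZ3.Theorems.Transplant.KNCells2KitResiduesRun
import HarnessLib

/-!
# Design (D), residue (C) DISCHARGED at run histories: `KSchA.ReachOblR` for the concentric scheme with the thin-between-box schedule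
# `concRadiiGB C gap gap' E₀ L'`, from the planar constants, the kit/link inputs at the running parameter, the counts and the schedule's
# gap conditions — the composition of p2-g2's `reachOblAt_concG` + `hkits_reachTCD`, stmt-g5's realised radii, and this seat's rim excess
# from deep entrances along runs (`real_rim_le_concG` ∘ `deep_of_run` ∘ p3-g2's `PlanarCellsPSep3`)

builds on p205010 (kernel theorem, internal audit signed; external expert review pending) — nothing in this file uses p205010.
Lane `prim-bschramm`, seat `prim-bschramm-p5` (gen 3, refuter; holder of residue (C); lead rulings 15:15:37Z / 15:35:49Z / 16:02:38Z),
helper file (`--supports stmt-CriticalPhenomena-4575`).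

* `nQ_tgt_eq_nS_src_succ` — at a chosen edge `(v, δ)`: `nQ α (v + δ) = nS α v + 1` (the examined cube is one generation above the source's);
* **`reachOblR_concGB`** — `KSchA.ReachOblR X (concSchemeG X C w₀ (concRadiiGB C gap gap' E₀ L') q δc) (faceDataCG …) Δ' δ` from: the planar
  constants (`C.r = 4t`, `100 R' ≤ t`, `Rlev + 1 ≤ R'`, `j₁ ≤ Rlev`, `R' + ℓ₀ ≤ t`, `M < ℓ₀`, `M + 1 ≤ j₀`), the inputs at the running `q`
  (`hstd` at the kit scale `M`, `hlink` at the route scales `[ℓ₀, 6t]`), the fibre constants (`ψ(M) ≤ E₀`, `ψ(6t) + ψ(M) ≤ L' ≤ E₀`), the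
  counts (`kk · kitB ≤ N`, `(1 - q^{kitSB})^{kk} ≤ δ`, `1/(1-q)^{Δ' N} ≤ δ · #Icc j₀ j₁`), `η ≤ δ/2`, and the schedule (`L' ≤ gap ρ`;
  `Rex (E g + 1) + L' ≤ E (g+1)` for an excess-radius function `Rex` valid at `q` in the shape of `exists_excess_radius` with `V₀ = {w₀}`,
  `n = 25 r`).  The tube chain data is p2-g2's `reachTCD`.
[cite: KozmaNitzan2024, §4 Lemma 12 (pp. 23–25), pp. 30–31]
-/

noncomputable section

open MeasureTheory ProbabilityTheory
open scoped ENNReal Classical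

namespace Summit.CriticalPhenomena.PercolationContinuityZ3.Theorems

namespace Transplant

namespace BoxProdZ2

open Literature.Probability.Percolation Literature.Probability.LatticeModels SimpleGraph GadgetSystem ProbeHistory HSiteScheme Contour KNCells
open Literature.Probability.Percolation.KozmaNitzan
open Literature.Probability.Percolation.KozmaNitzan.Cells (sgOf)
open Literature.Probability.Percolation.GM
open Literature.Barriers.CriticalPhenomena (mem_graphBall_self)
open KNLevels ChainPlanar

variable {W : Type} [DecidableEq W] (X : SimpleGraph W) [X.LocallyFinite]

section Run

variable (C : PCells) (w₀ : W) (gap gap' : ℕ → ℕ) (E₀ L' : ℕ) (q : unitInterval) (δc : ℝ)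

local notation "SS" => concSchemeG X C w₀ (concRadiiGB C gap gap' E₀ L') q δc
local notation "FDD" => faceDataCG X C w₀ (concRadiiGB C gap gap' E₀ L')
local notation "GG" => X □ zdGraph 2

/-- **At a chosen edge the examined cube is one generation above the source's own level**: `nQ α (tgt e) = nS α e.1 + 1`,
`α = aOf₁ h e` (unit-increment anchors; the root examines `±e_i` of generation `1`, its children examine cells of generation `2`).
[this work] -/
theorem nQ_tgt_eq_nS_src_succ [Countable W] (h : ProbeHistory (W × Site 2)) {e : Site 2 × MDir}
    (hc : ((SS).astOf₂ GG h).st.choice = some e) :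
    nQ ((SS).aOf₁ GG h e) (tgt e) = nS ((SS).aOf₁ GG h e) e.1 + 1 := by
  have hanch := concSchemeG_anchor X C w₀ (concRadiiGB C gap gap' E₀ L') q δc
  have h0 := concSchemeG_a₀ X C w₀ (concRadiiGB C gap gap' E₀ L') q δc
  set α := (SS).aOf₁ GG h e with hα
  by_cases hα0 : α = 0
  · rw [hα0, nQ, nS, if_pos rfl, if_pos rfl]
    rcases KSchA.anchors_of_choice_succ hanch h0 h hc with hβ | ⟨he1, -, -⟩
    · -- a child of the root examines a grandchild
      have hβ1 : (SS).aOf₂ GG h e = 1 := by rw [hβ, ← hα, hα0]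
      obtain ⟨d, hd⟩ := KSchA.src_eq_step_of_choice_dep_one hanch h0 h hβ1
      have he1 : e.1 = stepVec d := by rw [hd]; simp [GadgetSystem.tgt]
      have hne : e.1 ≠ 0 := by rw [he1]; exact stepVec_ne_zero d
      have hx : tgt e = stepVec d + stepVec e.2 := by simp [GadgetSystem.tgt, he1]
      rw [if_neg hne, hx, gen0_stepVec_add_stepVec (by rw [← hx]; exact KSchA.tgt_ne_zero_of_choice h hc)]
    · -- the root examines a neighbour
      rw [if_pos he1, show tgt e = stepVec e.2 by simp [GadgetSystem.tgt, he1], gen0_stepVec]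
  · rw [nQ, nS, if_neg hα0, if_neg hα0]

/-- **RESIDUE (C) AT RUN HISTORIES for the concentric scheme with the thin-between-box schedule.**
[cite: KozmaNitzan2024, §4 Lemma 12 (pp. 23–25), pp. 30–31] -/
theorem reachOblR_concGB [Countable W] {t R' Rlev N j₀ j₁ ℓ₀ : ℕ} (hr : C.r = 4 * t) (hR : 100 * R' ≤ t) (hRl : Rlev + 1 ≤ R')
    (hj : j₁ ≤ Rlev) (hℓ : R' + ℓ₀ ≤ t)
    {Δ : ℕ} (hΔ : ∀ w, X.degree w ≤ Δ) {p₀ : unitInterval} (hT : TubeSubcritical X p₀) (V₀ : Finset W)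
    (hfr : ∀ w : W, ∃ γ : X ≃g X, γ w ∈ V₀) {δ : ℝ} (hδ : 0 < δ) {msel : W → ℕ} {M : ℕ} (hmsel : ∀ τ ∈ V₀, msel τ ≤ M)
    (hstd : ∀ τ ∈ V₀,
      1 - δ ^ 2 < (bondPercolation (X □ zdGraph 2) q).real (UniqZone.zone (X □ zdGraph 2) (ufatSeq X hT V₀ τ) (msel τ) M) ∧
      ∀ g : HOct 2, 1 - δ ^ 2 < (bondPercolation (X □ zdGraph 2) q).real
        (linkIn (↑(ufatSeq X hT V₀ τ M)) (ufatSeq X hT V₀ τ (msel τ)) (ballFin X τ (ufatRadius X hT V₀ M) ×ˢ piece g M)))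
    (hMℓ : M < ℓ₀)
    (hlink : ∀ ℓ, ℓ₀ ≤ ℓ → ℓ ≤ 6 * t → ∀ τ ∈ V₀, ∀ g : HOct 2, 1 - δ ^ 2 < (bondPercolation (X □ zdGraph 2) q).real
      (linkIn (↑(ufatSeq X hT V₀ τ ℓ)) (ufatSeq X hT V₀ τ (msel τ)) (ballFin X τ (ufatRadius X hT V₀ ℓ) ×ˢ piece g ℓ)))
    (hE₀M : ufatRadius X hT V₀ M ≤ E₀) (hLψ : ufatRadius X hT V₀ (6 * t) + ufatRadius X hT V₀ M ≤ L') (hE₀L : L' ≤ E₀)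
    (hj₀ : M + 1 ≤ j₀) (kk : ℕ) (hN : kk * kitB Δ M (ufatRadius X hT V₀ M) ≤ N)
    (hk : (1 - (q : ℝ) ^ kitSB Δ M (ufatRadius X hT V₀ M)) ^ kk ≤ δ)
    {Δ' : ℕ} {η : ℝ} (hcount : 1 / (1 - (q : ℝ)) ^ (Δ' * N) ≤ δ * ((Finset.Icc j₀ j₁).card : ℝ)) (hη : η ≤ δ / 2)
    (hgapL : ∀ ρ, L' ≤ gap ρ) {Rex : ℕ → ℕ}
    (hRex : ∀ R₀' R₁, Rex R₀' ≤ R₁ → ∀ τ ∈ ({w₀} : Finset W), ∀ (Rw : ℕ) (D' A' : Finset (W × Site 2)),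
      D' ⊆ ballFin X τ Rw ×ˢ box 2 (25 * C.r) → A' ⊆ D' → (∀ a ∈ A', a.1 ∈ ballFin X τ R₀') →
      (bondPercolation (X □ zdGraph 2) q).real (excess X τ R₁ D' A') ≤ η)
    (hsch : ∀ g, Rex (Erad gap gap' E₀ g + 1) + L' ≤ Erad gap gap' E₀ (g + 1)) :
    KSchA.ReachOblR X SS FDD Δ' δ := by
  intro h e hrun hc hV du hdu
  obtain ⟨ω, n, rfl⟩ := hrun
  -- abbreviations
  set Λ := concRadiiGB C gap gap' E₀ L' with hΛdef
  set S := SS with hSdef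
  set G := GG with hGdef
  set hh := S.hst₂ G ω n with hhdef
  set α := S.aOf₁ G hh e with hαdef
  set β := S.aOf₂ G hh e with hβdef
  set E := Erad gap gap' E₀ (nQ α (tgt e)) with hEdef
  have hΛWF : Λ.WF C := concRadiiGB_WF C gap gap' E₀ L'
  set P := reachTCD X C w₀ E L' (tgt e) du t R' Rlev N j₀ j₁ (S.Sx G hh e α β du) with hPdef
  -- the realised triple and the schedule's radii
  have hreal : Realised α β (tgt e) := realised_of_choice hh hc
  have hy : tgt e + stepVec du ≠ 0 := tgt_add_stepVec_ne_zero hV hdu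
  have hEQ : Λ.rQ α (tgt e) = E := rfl
  have hρ : ∀ ℓ, Λ.ρ β (tgt e) du ℓ = E := fun ℓ => ρ_real C gap gap' E₀ L' hreal hy ℓ
  have hB : Λ.rB α e.1 e.2 ≤ E := by
    rw [concRadiiGB_rB, concRadiiGB_rE]
    exact min_le_right _ _
  have hEfar : E ≤ Λ.rE β (tgt e) du := by
    rw [rE_real C gap gap' E₀ L' hreal hy, Frad_succ]
    exact Nat.le_add_right _ _
  have hM : E ≤ Λ.rM β (tgt e + stepVec du) := by
    rw [rM_succ_real C gap gap' E₀ L' hreal hy, Frad_succ]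
    exact Nat.le_sub_of_add_le (Nat.add_le_add_left (hgapL _) _)
  -- `E₀ ≤ E`: the kit radius and `L'` fit in the window
  have hE₀E : E₀ ≤ E := by
    have h0 : Erad gap gap' E₀ 0 ≤ E := Erad_mono gap gap' E₀ (Nat.zero_le _)
    simpa [Erad] using h0
  have hnF : ufatRadius X hT V₀ M ≤ E := hE₀M.trans hE₀E
  have hLE : L' ≤ E := hE₀L.trans hE₀E
  -- the source level and the entrance radius
  have hgen : nQ α (tgt e) = nS α e.1 + 1 := nQ_tgt_eq_nS_src_succ X C w₀ gap gap' E₀ L' q δc hh hc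
  have hR₀E : Erad gap gap' E₀ (nS α e.1) ≤ E := Erad_mono gap gap' E₀ (by rw [hgen]; exact Nat.le_succ _)
  have hRexE : Rex (Erad gap gap' E₀ (nS α e.1) + 1) ≤ E - L' := by
    refine Nat.le_sub_of_add_le ?_
    rw [hEdef, hgen]
    exact hsch _
  -- the choice at the run's macro-state
  have hc' : ((S.scheme₂ G).stN n ω).choice = some e := by rw [S.stN_eq₂]; exact hc
  -- deep entrances along the run (planar separation off the lineage: p3-g2's PSep3)
  have hdeep := deep_of_run X C w₀ gap gap' E₀ L' q δc
    (fun v δ' du' u h1 h2 h3 h4 => C.Q_sep_probeWorld v δ' du' u h1 h2 h3 h4)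
    (fun v δ' du' w δ'' h1 h2 h3 h4 h5 h6 => C.Btw_sep_probeWorld v δ' du' w δ'' h1 h2 h3 h4 h5 h6)
    (fun v δ' du' u d j h1 h2 h3 h4 h5 => C.Stub_sep_probeWorld v δ' du' u d j h1 h2 h3 h4 h5) ω n hc' hdu β
  -- the rim parts: inside the regions, beyond fibre radius `E - L'`
  have hRimD : ∀ i, P.Rim i ⊆ P.stepD i := reachTCD_Rim_subset X C w₀ E L' (tgt e) du t R' Rlev N j₀ j₁ _
  have hRimfar : ∀ i, ∀ w ∈ P.Rim i, w.1 ∉ ballFin X w₀ (E - L') := fun i w hw =>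
    (Finset.mem_sdiff.1 (Finset.mem_product.1 hw).1).2
  -- the rim excess
  have hexc : ∀ i ≤ Sched.nLast, (prodBernoulli (S.Wcor G FDD hh e α β du)).real
      (⋃ t' ∈ P.Rim i, openConn ((w₀, (0 : Site 2)) : W × Site 2) t') ≤ η := by
    intro i hi
    refine real_rim_le_concG X C w₀ hΛWF hV hdu hEQ hρ hB hEfar hR₀E hdeep (hRex _) hRexE ?_ (hRimfar i)
    exact (hRimD i).trans (TubeChainData.stepD_subset (P := P) hr hR hi)
  -- the kit clauses (p2-g2)
  have hkits := hkits_reachTCD X C w₀ hΛWF hV hdu (S.Sx G hh e α β du) hEQ hρ hB hEfar hr hR hRl hj hℓ hΔ hT V₀ hfr hδ hmsel hstd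
    hMℓ hlink hnF hLψ hLE hj₀ kk hN hk
  exact reachOblAt_concG X C w₀ hΛWF hV hdu P rfl rfl rfl rfl rfl rfl hRimD hEQ hρ hB hEfar hM hr hR hRl hj hcount hkits hη hexc

end Run

end BoxProdZ2

end Transplant

end Summit.CriticalPhenomena.PercolationContinuityZ3.Theorems

end
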